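import Summits.QuantumFields.YangMills.Theorems.BalabanLadderIRPinnedExitCofinal
import HarnessLib

/-!
# Crux `IRcof` (stmt-QuantumFields-26930) — lens «embed» (ideator ym-ir-idea-18 g0): the YM–Higgs dictionary, TYPED, and why it is purity-inert
# (sorry-free WORKFILE, NOT a line: no `stub_*`, nothing concludes the slot token; companion of `EMBED-OBSTRUCTIONS-ym-ir-idea-18-g0.md`)

HONEST LABEL.  Nothing here proves PXcof(1∕24) (THE NUMBER), N_cof, `Theses.BalabanLadder.IRcof` (26930), `BalabanLadder.IR` (19354), a lattice
mass gap or the Clay Yang–Mills mass gap; R4 closes only the conditional finite-𝕋⁴ rung `BalabanLadder.UV`; R2c stays IDEA-BOUND; nothing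
continuum ∕ OS ∕ Clay.  The two `Prop`s of §2 are HYPOTHESIS-side statements (REGIME ∕ OPEN); §3's lemma is elementary real analysis.

CONTENT (the director's lens R459-ym №31 idea-18: «THE NUMBER as the κ = 0 edge of the lattice YM–Higgs purity surface P(β, κ)»).
* §1 DICTIONARY, literal: `higgsFinTorusPartition ρ β κ n₀ n₁ n₂ n₃` = Wilson's torus partition function with a FROZEN (unit-length) Higgs field
  in the representation `ρ`, unitary gauge, ISOTROPIC hopping `κ` on every link (weight `exp(κ Σ_ℓ Re tr ρ(U_ℓ))`), and `staticChargeFinTorusPartition`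
  = the same with hopping on TEMPORAL links only (direction `3`; a gas of static charges with fugacity-type weight).  PROVED: at `κ = 0` both ARE
  `wilsonFinTorusPartition` (`…_zero`), hence `higgsColdDefect ρ β 0 L = coldDefect ρ β L` and `staticColdDefect ρ β 0 L = coldDefect ρ β L` —
  the κ = 0 edge of the purity surface is THE NUMBER's defect by `simp`, as the critic's embed check (GATE-CARD wave 2, G-embed) demands.
* §2 THE BEST DRAFT, typed and NOT filed: `HiggsPurityRung` (R_OS — deep-Higgs-regime purity of the cold 4:1 boxes for `κ ≥ κ₀(β)`, ALL `β ≥ 0`;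
  REGIME statement in the class of Osterwalder–Seiler 1978 Thm 4.1 ∕ Seiler LNP 159 §5, whose convergence radius depends on the gauge coupling:
  `κ₀ = κ₀(β)`) and `HiggsDescent` (the lens's FIRST NON-TRANSFERRING STEP: from the rung down to `κ = 0` on the pinned boxes).  PROVED:
  `pinnedPure_of_rung_descent : HiggsPurityRung → HiggsDescent → PXcof(1∕24)-body` (the composition the line would have been) AND
  `higgsDescent_of_pinnedPure : PXcof(1∕24)-body → HiggsDescent` (three lines) — i.e. the descent is PXcof weakened by a TRUE hypothesis, with no
  located mechanism behind it (memo O1–O3: for SU(2) the κ-path crosses the first-order Higgs transition for β > β_E ≈ 2.73; κ-continuity of the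
  defect is row 28 ∕ 56 of the SAME-WALL table in κ-dress; no κ-monotone purity functional exists for isotropic hopping).  That is why no
  `Lines/…` file was written: by the seat's own C0 the draft is predicted tier C (Attack = 1).
* §3 PURITY-INERTNESS OF THE STATIC-CHARGE HALF (kernel part of memo O2): `defect_sub_le_two_mul_defect` — for a finite family of nonnegative
  weights whose maximum lies in a subfamily `s`, the period-doubling defect of `s` is at most twice that of the whole family.  Reading (prose,
  transfer-matrix picture of the temporal-hopping model: `Z_κ(L³×t) = Σ_sectors w(q)^t · tr 𝕋₀^t|_q`, `w(0) = 1`, `0 ≤ w ≤ 1`, vacuum in the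
  Gauss-law sector `q = 0` whose trace IS `wilsonFinTorusPartition`): `coldDefect ρ β L ≤ 2 · staticColdDefect ρ β κ L` for EVERY `κ ≥ 0` — adding
  charged sectors can only dilute the vacuum, so purity transfers from the deformed model TO Yang–Mills, never the other way: the deformation
  cannot make THE NUMBER easier (an `∃ κ`-form is kernel-equivalent to PXcof up to tolerance, a `∀ κ`∕`κ = ∞` form is a ≥-load).
-/

set_option autoImplicit false

noncomputable section

open Filter Topology MeasureTheory
open scoped BigOperators
open Literature.MathematicalPhysics.QuantumFieldTheory
open Summit.QuantumFields.YangMills.Cruxes.OSLegsFromFemtoAndGap.DlrCollarTransfer (LowerBounds)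
open Summit.QuantumFields.YangMills.Cruxes.IR.ColdPurityBridge (coldDefect)

namespace Summit.QuantumFields.YangMills.Cruxes.IRcof.EmbedHiggsEdge

/-! ## §1 The dictionary: lattice Yang–Mills–Higgs (frozen Higgs, unitary gauge) on the `Fin`-torus, and its κ = 0 edge -/

section Dictionary

variable {G : Type} [Group G] {n : ℕ} (ρ : G →* Matrix (Fin n) (Fin n) ℂ) [TopologicalSpace G] [IsTopologicalGroup G]
  [CompactSpace G] [MeasurableSpace G] [BorelSpace G]

/-- **Lattice Yang–Mills–Higgs partition function, frozen Higgs in representation `ρ`, unitary gauge, isotropic hopping `κ`** on the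
anisotropic `Fin`-torus `n₀ × n₁ × n₂ × n₃`: `∫ exp(−β S_W(U)) · exp(κ Σ_{links ℓ} Re tr ρ(U_ℓ)) ∏ dHaar`.  (`ρ` injective + unitary ⇒ the hopping
term is maximal exactly at `U_ℓ = 1`: complete breakdown, the Fradkin–Shenker ∕ Osterwalder–Seiler setting.)
[cite: FradkinShenker1979] [cite: OsterwalderSeiler1978, §4] [cite: MontvayMunster1994, §6.1] -/
def higgsFinTorusPartition (β κ : ℝ) (n₀ n₁ n₂ n₃ : ℕ) : ℝ :=
  ∫ U, Real.exp (-β * ∑ x : FinTorusSite n₀ n₁ n₂ n₃, ∑ q : {q : Fin 4 × Fin 4 // q.1 < q.2},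
      ((n : ℝ) - (ρ (finTorusPlaquette U x q.1.1 q.1.2)).trace.re)) *
      Real.exp (κ * ∑ l : FinTorusSite n₀ n₁ n₂ n₃ × Fin 4, (ρ (U l)).trace.re)
    ∂(Measure.pi fun _ : FinTorusSite n₀ n₁ n₂ n₃ × Fin 4 => haarProbability G)

/-- **Static-charge deformation**: the same with hopping on the TEMPORAL links `(x, 3)` only — weight `exp(κ Σ_x Re tr ρ(U_{x,3}))`, a gas of
static colour charges in representation `ρ` (the heavy-matter ∕ Polyakov-line fugacity term of the hopping expansion, kept to lowest order).
[cite: MontvayMunster1994, §5.4] -/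
def staticChargeFinTorusPartition (β κ : ℝ) (n₀ n₁ n₂ n₃ : ℕ) : ℝ :=
  ∫ U, Real.exp (-β * ∑ x : FinTorusSite n₀ n₁ n₂ n₃, ∑ q : {q : Fin 4 × Fin 4 // q.1 < q.2},
      ((n : ℝ) - (ρ (finTorusPlaquette U x q.1.1 q.1.2)).trace.re)) *
      Real.exp (κ * ∑ x : FinTorusSite n₀ n₁ n₂ n₃, (ρ (U (x, (3 : Fin 4)))).trace.re)
    ∂(Measure.pi fun _ : FinTorusSite n₀ n₁ n₂ n₃ × Fin 4 => haarProbability G)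

/-- **κ = 0 edge (isotropic)**: the Yang–Mills–Higgs partition function at `κ = 0` IS Wilson's. [folklore] -/
theorem higgsFinTorusPartition_zero (β : ℝ) (n₀ n₁ n₂ n₃ : ℕ) :
    higgsFinTorusPartition ρ β 0 n₀ n₁ n₂ n₃ = wilsonFinTorusPartition ρ β n₀ n₁ n₂ n₃ := by
  simp only [higgsFinTorusPartition, wilsonFinTorusPartition, zero_mul, Real.exp_zero, mul_one]

/-- **κ = 0 edge (static charges)**: the static-charge deformation at `κ = 0` IS Wilson's. [folklore] -/
theorem staticChargeFinTorusPartition_zero (β : ℝ) (n₀ n₁ n₂ n₃ : ℕ) :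
    staticChargeFinTorusPartition ρ β 0 n₀ n₁ n₂ n₃ = wilsonFinTorusPartition ρ β n₀ n₁ n₂ n₃ := by
  simp only [staticChargeFinTorusPartition, wilsonFinTorusPartition, zero_mul, Real.exp_zero, mul_one]

/-- **The purity surface `P(β, κ)` in THE NUMBER's currency**: the cold period-doubling defect of the Yang–Mills–Higgs model on the seed's
`4:1` boxes, `1 − Z_{β,κ}(L³×2⌊L/4⌋) / Z_{β,κ}(L³×⌊L/4⌋)²`. -/
def higgsColdDefect (β κ : ℝ) (L : ℕ) : ℝ :=
  1 - higgsFinTorusPartition ρ β κ L L L (2 * (L / 4)) / higgsFinTorusPartition ρ β κ L L L (L / 4) ^ 2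

/-- The cold period-doubling defect of the static-charge deformation. -/
def staticColdDefect (β κ : ℝ) (L : ℕ) : ℝ :=
  1 - staticChargeFinTorusPartition ρ β κ L L L (2 * (L / 4)) / staticChargeFinTorusPartition ρ β κ L L L (L / 4) ^ 2

/-- **DICTIONARY, literal**: `P(β, κ = 0) = coldDefect` — the κ = 0 edge of the purity surface is THE NUMBER's defect. [folklore] -/
theorem higgsColdDefect_zero (β : ℝ) (L : ℕ) : higgsColdDefect ρ β 0 L = coldDefect ρ β L := by
  simp only [higgsColdDefect, coldDefect, higgsFinTorusPartition_zero]

/-- Same for the static-charge deformation. [folklore] -/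
theorem staticColdDefect_zero (β : ℝ) (L : ℕ) : staticColdDefect ρ β 0 L = coldDefect ρ β L := by
  simp only [staticColdDefect, coldDefect, staticChargeFinTorusPartition_zero]

end Dictionary

/-! ## §2 The best draft of the lens, typed — and the three-line certificate of why it is NOT filed -/

/-- **R_OS `HiggsPurityRung` — DEEP-HIGGS-REGIME PURITY (REGIME statement; HYPOTHESIS-side `Prop`, OPEN in the tree).**  For every compact simple
simply-connected `G` and every lattice representation `r` there are a threshold map `κ₀ : ℝ → ℝ` and a side `L₁` such that for ALL `β ≥ 0`, all
`κ ≥ κ₀ β` and all `L ≥ L₁` the cold 4:1 Yang–Mills–Higgs box is `1∕48`-pure.  Why plausibly true: for `κ ≫ 1 + β` the single-link weights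
`exp(κ Re tr ρ(U))` concentrate at `U = 1` (complete breakdown), the plaquette term is a perturbation of relative size `β∕κ`, and a convergent
polymer expansion gives a mass `≥ 1` in lattice units uniformly, whence `δ ≤ C L³ e^{−L/4}` — the Osterwalder–Seiler Higgs-region expansion, whose
radius DEPENDS ON THE GAUGE COUPLING (`κ₀(β) → ∞`).  Why it might fail as typed: only bookkeeping (thermal trace ∕ finite-size form of the cluster
expansion on the 4:1 torus).  It is the lens's only bankable product and it says nothing at `κ = 0`.
[cite: OsterwalderSeiler1978, Thm 4.1] [cite: Seiler1982, §5] [cite: FradkinShenker1979] -/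
def HiggsPurityRung : Prop :=
  ∀ (G : Type) [Group G] [TopologicalSpace G] [IsTopologicalGroup G] [CompactSpace G],
    IsCompactSimpleLieGroup G → SimplyConnectedSpace G →
    letI : MeasurableSpace G := borel G
    haveI : BorelSpace G := ⟨rfl⟩
    ∀ r : LatticeRep G, ∃ (κ₀ : ℝ → ℝ) (L₁ : ℕ), ∀ β : ℝ, 0 ≤ β → ∀ κ : ℝ, κ₀ β ≤ κ →
      ∀ L : ℕ, L₁ ≤ L → higgsColdDefect r.ρ β κ L ≤ 1 / 48

/-- **D `HiggsDescent` — THE FIRST NON-TRANSFERRING STEP of the lens (HYPOTHESIS-side `Prop`; the draft crux, NOT filed).**  Under IRcof's own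
binders and floor: IF the deep-Higgs rung holds with some `(κ₀, L₁)`, THEN the pinned cofinal `1∕24`-pure boxes exist AT `κ = 0`.  `PXcof(1∕24) ⇒ D`
by ignoring the hypothesis (`higgsDescent_of_pinnedPure`), and no mechanism transports purity from `κ ≥ κ₀(β)` to `κ = 0` at large `β`
(first-order Higgs transition in between for SU(2), β > β_E; see the memo) — so D is THE NUMBER in Higgs dress: recorded, not staffed. -/
def HiggsDescent : Prop :=
  ∀ (G : Type) [Group G] [TopologicalSpace G] [IsTopologicalGroup G] [CompactSpace G],
    IsCompactSimpleLieGroup G → SimplyConnectedSpace G →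
    letI : MeasurableSpace G := borel G
    haveI : BorelSpace G := ⟨rfl⟩
    ∀ (r : LatticeRep G) (a : ℝ → ℝ), (∀ β, 0 < a β) → Tendsto a atTop (𝓝 0) → LowerBounds G r a →
      ∀ (κ₀ : ℝ → ℝ) (L₁ : ℕ),
        (∀ β : ℝ, 0 ≤ β → ∀ κ : ℝ, κ₀ β ≤ κ → ∀ L : ℕ, L₁ ≤ L → higgsColdDefect r.ρ β κ L ≤ 1 / 48) →
        ∃ T : ℝ, ∀ β₁ : ℝ, ∃ β : ℝ, β₁ ≤ β ∧ ∃ L : ℕ, 8 ≤ L ∧ a β * (L : ℝ) ≤ T ∧ higgsColdDefect r.ρ β 0 L ≤ 1 / 24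

/-- **The composition the line would have been** (PROVED): rung ∧ descent ⇒ the body of the 26930 slot's registered stub
`PinnedCofinalBill.stub_pinnedExitsCofinal : PinnedExitsCofinalAt (1/24)`, spelled verbatim (as in `PinnedExitCofinal.pinnedExitsCofinal_of_pinnedExitAt`). -/
theorem pinnedPure_of_rung_descent (hR : HiggsPurityRung) (hD : HiggsDescent) :
    ∀ (G : Type) [Group G] [TopologicalSpace G] [IsTopologicalGroup G] [CompactSpace G],
      IsCompactSimpleLieGroup G → SimplyConnectedSpace G →
      letI : MeasurableSpace G := borel G
      haveI : BorelSpace G := ⟨rfl⟩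
      ∀ (r : LatticeRep G) (a : ℝ → ℝ), (∀ β, 0 < a β) → Tendsto a atTop (𝓝 0) → LowerBounds G r a →
        ∃ T : ℝ, ∀ β₁ : ℝ, ∃ β : ℝ, β₁ ≤ β ∧ ∃ L : ℕ, 8 ≤ L ∧ a β * (L : ℝ) ≤ T ∧ coldDefect r.ρ β L ≤ 1 / 24 := by
  intro G _ _ _ _ hG hsc
  letI : MeasurableSpace G := borel G
  haveI : BorelSpace G := ⟨rfl⟩
  intro r a ha ha0 hlb
  obtain ⟨κ₀, L₁, hrung⟩ := hR G hG hsc r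
  obtain ⟨T, hT⟩ := hD G hG hsc r a ha ha0 hlb κ₀ L₁ hrung
  refine ⟨T, fun β₁ => ?_⟩
  obtain ⟨β, hβ, L, hL, hpin, hδ⟩ := hT β₁
  exact ⟨β, hβ, L, hL, hpin, by rwa [higgsColdDefect_zero] at hδ⟩

/-- **Why D is not filed (PROVED, three lines)**: THE NUMBER implies the descent outright — `D` is PXcof(1∕24) weakened by a hypothesis, and the
hypothesis (R_OS) is true in print; with no located mechanism for the descent this is the №13 costume the census predicted (§K B-MATTERBLIND). -/
theorem higgsDescent_of_pinnedPure
    (hPX : ∀ (G : Type) [Group G] [TopologicalSpace G] [IsTopologicalGroup G] [CompactSpace G],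
      IsCompactSimpleLieGroup G → SimplyConnectedSpace G →
      letI : MeasurableSpace G := borel G
      haveI : BorelSpace G := ⟨rfl⟩
      ∀ (r : LatticeRep G) (a : ℝ → ℝ), (∀ β, 0 < a β) → Tendsto a atTop (𝓝 0) → LowerBounds G r a →
        ∃ T : ℝ, ∀ β₁ : ℝ, ∃ β : ℝ, β₁ ≤ β ∧ ∃ L : ℕ, 8 ≤ L ∧ a β * (L : ℝ) ≤ T ∧ coldDefect r.ρ β L ≤ 1 / 24) :
    HiggsDescent := by
  intro G _ _ _ _ hG hsc
  letI : MeasurableSpace G := borel G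
  haveI : BorelSpace G := ⟨rfl⟩
  intro r a ha ha0 hlb κ₀ L₁ _hrung
  obtain ⟨T, hT⟩ := hPX G hG hsc r a ha ha0 hlb
  refine ⟨T, fun β₁ => ?_⟩
  obtain ⟨β, hβ, L, hL, hpin, hδ⟩ := hT β₁
  exact ⟨β, hβ, L, hL, hpin, by rwa [higgsColdDefect_zero]⟩

/-! ## §3 Purity-inertness of the static-charge half: charged sectors can only dilute the vacuum -/

/-- **Sector-dilution inequality** (elementary).  Let `z ≥ 0` be finitely many weights on `t ⊇ s` whose MAXIMUM over `t` is attained at some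
`i₀ ∈ s` with `z i₀ > 0`.  Then the period-doubling defect of the subfamily is at most twice that of the whole family:
`1 − (Σ_s z²)/(Σ_s z)² ≤ 2 · (1 − (Σ_t z²)/(Σ_t z)²)`.  Proof: with `u = z i₀ / Σ_s z ∈ (0,1]`, `(Σ_s z²)/(Σ_s z)² ≥ u²` and
`(Σ_t z²)/(Σ_t z)² ≤ z i₀/Σ_t z ≤ u`, and `1 − u² ≤ 2(1 − u)`.  READING (memo O2): `s` = the thermal weights `λᵢ^t` of the Gauss-law (vacuum)
sector — whose sums ARE `wilsonFinTorusPartition` at extents `t`, `2t` —, `t ∖ s` = the charged sectors of the static-charge deformation with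
weights `w(q)^t λ^t`, `0 ≤ w ≤ 1`; squaring the weights is time-doubling.  Hence `coldDefect ≤ 2 · staticColdDefect κ` for every `κ ≥ 0`: the
deformation can never make the pinned boxes purer than Yang–Mills already is, i.e. it transfers purity in the useless direction. [folklore] -/
theorem defect_sub_le_two_mul_defect {ι : Type*} (s t : Finset ι) (hst : s ⊆ t) (z : ι → ℝ) (hz : ∀ i ∈ t, 0 ≤ z i)
    (i₀ : ι) (hi₀ : i₀ ∈ s) (hpos : 0 < z i₀) (hmax : ∀ i ∈ t, z i ≤ z i₀) :
    1 - (∑ i ∈ s, z i ^ 2) / (∑ i ∈ s, z i) ^ 2 ≤ 2 * (1 - (∑ i ∈ t, z i ^ 2) / (∑ i ∈ t, z i) ^ 2) := by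
  set A := ∑ i ∈ s, z i with hA_def
  set A₂ := ∑ i ∈ s, z i ^ 2 with hA₂_def
  set B := ∑ i ∈ t, z i with hB_def
  set B₂ := ∑ i ∈ t, z i ^ 2 with hB₂_def
  set M := z i₀ with hM_def
  have hzs : ∀ i ∈ s, 0 ≤ z i := fun i hi => hz i (hst hi)
  have hMA : M ≤ A := by
    rw [hA_def]
    exact Finset.single_le_sum hzs hi₀
  have hA : 0 < A := lt_of_lt_of_le hpos hMA
  have hAB : A ≤ B := Finset.sum_le_sum_of_subset_of_nonneg hst fun i hi _ => hz i hi
  have hB : 0 < B := lt_of_lt_of_le hA hAB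
  have hA₂ : M ^ 2 ≤ A₂ := by
    rw [hA₂_def]
    exact Finset.single_le_sum (f := fun i => z i ^ 2) (fun i _ => sq_nonneg (z i)) hi₀
  have hB₂ : B₂ ≤ M * B := by
    rw [hB₂_def, hB_def, Finset.mul_sum]
    exact Finset.sum_le_sum fun i hi => by nlinarith [hz i hi, hmax i hi]
  set u := M / A with hu_def
  have h1 : u ^ 2 ≤ A₂ / A ^ 2 := by
    rw [hu_def, div_pow]
    gcongr
  have h2 : B₂ / B ^ 2 ≤ u := by
    calc B₂ / B ^ 2 ≤ M * B / B ^ 2 := by gcongr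
      _ = M / B := by rw [pow_two, mul_div_mul_right _ _ hB.ne']
      _ ≤ M / A := by
        rw [hM_def] at hpos ⊢
        gcongr
  have h3 : 1 - u ^ 2 ≤ 2 * (1 - u) := by nlinarith [sq_nonneg (1 - u)]
  linarith

end Summit.QuantumFields.YangMills.Cruxes.IRcof.EmbedHiggsEdge
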